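import Literature.NumberTheory.GaloisRepresentations.LubinTateColemanTwoVariableTwistFrobTwo
import HarnessLib

/-!
# The two-variable Coleman transform under an ARBITRARY `σ̃ ∈ Γ_F`: `Col(σ̃·β) = (1 + D_{χ(σ̃)}^{𝒪⟦X⟧})(g_{σ̃}·Col(β))` with `g_{σ̃} ∈ 𝒪_F⟦X⟧` the
# Amice element of `σ̃|_{E_∞} ∈ Gal(E_∞/F) ≅ ℤ_p` (`g_{σ̃} ≡ (1+X)^{a_m} mod ω_m` when `σ̃|_{E_m} = φ_m^{a_m}`) (de Shalit I §3.1, §3.4, §3.8 (17), III §1.3)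

De Shalit, *Iwasawa theory of elliptic curves with complex multiplication* (1987), Ch. I §3.1 (`Λ = ℤ_p⟦Γ'⟧ ≅ ℤ_p⟦S⟧`, `u^α ↦ (1+S)^α` for
`α ∈ ℤ_p`) and §3.4/§3.8: Coleman's map is a homomorphism of modules over the completed group ring of the WHOLE Galois group.
`LubinTateColemanTwoVariableTwistFrobTwo` gave the action of the generating set `{σ₀} ∪ {σ̃ : σ̃|_{E_∞} = 1}`; this file treats every
`σ̃ ∈ Γ_F` at once.  On each layer `σ̃|_{E_m} = σ₀^{a_m}|_{E_m}` (`exists_forall_smul_eq_pow_smul`) with `a_{m+1} ≡ a_m (mod p^m)`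
(`φ_m` has order `p^m`), so the powers `(1+X)^{a_m}` are `ω_m`-compatible and converge (Washington 7.1, `IwasawaAlgebraOmegaLimit`) to the
Amice element `g_{σ̃} ∈ 𝒪_F⟦X⟧` of `σ̃|_{E_∞}`:

* `restrictNormal_pow_eq_of_forall_smul_eq`, `modEq_of_forall_smul_eq` (`σ₀^a = σ₀^b` on `E_m` ⟹ `a ≡ b mod p^m`),
  `omega_dvd_pow_sub_pow_of_modEq` (`a ≡ b mod p^m ⟹ ω_m ∣ (1+X)^a − (1+X)^b`);
* ★★ `exists_amice_galois` — **for every `σ̃` there is `g ∈ 𝒪_F⟦X⟧` with `ω_m ∣ g − (1+X)^{a_m}`, `σ̃|_{E_m} = σ₀^{a_m}|_{E_m}`, for all `m`**;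
  `amice_galois_unique`; `amice_galois_of_forall_smul_eq` (`g = 1` for `σ̃` fixing `E_∞`), `amice_galois_frob` (`g = 1 + X` for `σ₀`) — linking
  with `colemanTransform₂_galAct_eq` / `colemanTransform₂_frob_galAct_eq`; ★ `amice_galois_mul` (**`g_{σ̃τ̃} = g_{σ̃}·g_{τ̃}`**: `σ̃ ↦ g_{σ̃}` is a
  homomorphism `Γ_F → 𝒪_F⟦X⟧^×` through `Gal(E_∞/F)`);
* ★ `series_amice_frob_pow` (`C((1+X)^a)·G` is a transform of `((r_m)^{φ_m^a})_m`), ★★ `series_amice_galois` (**`C(g)·G` is a transform of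
  `((r_m)^{σ̃|E_m})_m`**);
* ★★★ `colemanTransform₂_galois_eq` — **`Col(σ̃·β) = (1 + D^{𝒪⟦X⟧}_{χ(σ̃)})(C(g_{σ̃})·Col(β))` for EVERY `σ̃ ∈ Γ_F`**: the two-variable Coleman
  transform intertwines the whole Galois group of the two-variable local tower with the `𝒪_F⟦X⟧⟦T⟧ = Λ(ℤ_p × Γ')`-structure of
  `𝒪_F⟦X⟧⟦Y⟧ = Λ·1 ⊕ Λ·Y` (`σ̃ ↦ (g_{σ̃}, 1 + D_{χ(σ̃)})`).

Everything PROVED (0 sorry, no named facts, no new definitions).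

## References

* E. de Shalit, *Iwasawa theory of elliptic curves with complex multiplication* (1987), Ch. I §3.1, §3.4, §3.8 (17); Ch. III §1.3. [deShalit1987]
* L. C. Washington, *Introduction to Cyclotomic Fields*, 2nd ed. (1997), §7.1. [Washington1997]
* J.-P. Serre, *Local Fields* (1979), Ch. I §4 Prop. 10, Ch. IV §4 Prop. 16. [SerreLocalFields1979]
-/

noncomputable section

open scoped PowerSeries.WithPiTopology

namespace Literature.NumberTheory.GaloisRepresentations

section TwoVariableTwistGaloisTwo

open GaloisRepresentations.IsNonarchimedeanLocalField LubinTate ValuativeRel Field Finset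
open Literature.NumberTheory.EllipticCurves.IwasawaOmega

variable {F : Type} [Field F] [ValuativeRel F] [TopologicalSpace F] [IsNonarchimedeanLocalField F]

attribute [local instance] ltNormUniformSpace ltNormIsUniformAddGroup rk1 nF nE fintypeResidueField

variable {π : 𝒪[F]} (hπ : (valuation F).IsUniformizer (π : F)) (hq : residueFieldCard F = 2)
variable (p : ℕ) [hp : Fact p.Prime]

/-! ### Exponents of `σ̃` on the layers and their compatibility -/

omit [ValuativeRel F] [TopologicalSpace F] [IsNonarchimedeanLocalField F] in
/-- `σ₀^a|_E = σ₀^b|_E` as automorphisms of `E` when they agree on `E ⊆ F̄`. [cite: SerreLocalFields1979, Ch. I §4 Prop. 10] -/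
theorem restrictNormal_pow_eq_of_forall_smul_eq (E : IntermediateField F (AlgebraicClosure F)) [Normal F E] (σ₀ : absoluteGaloisGroup F)
    {a b : ℕ} (h : ∀ x : E, (σ₀ ^ a) • (x : AlgebraicClosure F) = (σ₀ ^ b) • (x : AlgebraicClosure F)) :
    ((absoluteGaloisGroup.toAlgEquiv F σ₀).restrictNormal E) ^ a = ((absoluteGaloisGroup.toAlgEquiv F σ₀).restrictNormal E) ^ b := by
  have hpow : ∀ (n : ℕ) (x : E), (((((absoluteGaloisGroup.toAlgEquiv F σ₀).restrictNormal E) ^ n) x : E) : AlgebraicClosure F) =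
      (σ₀ ^ n) • (x : AlgebraicClosure F) := by
    intro n
    induction n with
    | zero => intro x; rw [pow_zero, pow_zero, one_smul, AlgEquiv.one_apply]
    | succ n ih => intro x; rw [pow_succ', AlgEquiv.mul_apply, coe_restrictNormal_apply, ih, pow_succ', mul_smul]
  refine AlgEquiv.ext fun x => Subtype.ext ?_
  have h1 := hpow a x
  have h2 := hpow b x
  rw [h] at h1
  exact h1.trans h2.symm

/-- **`σ₀^a|_{E_m} = σ₀^b|_{E_m} ⟹ a ≡ b (mod [E:F])`** (`φ|_E` has order `[E:F]`). [cite: SerreLocalFields1979, Ch. I §4 Prop. 10] -/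
theorem modEq_of_forall_smul_eq (E : IntermediateField F (AlgebraicClosure F)) [FiniteDimensional F E] [Normal F E] [IsGalois F E]
    (hE : E ≤ maxUnramified F) {σ₀ : absoluteGaloisGroup F} (hσ₀ : IsAbsArithFrob σ₀) {a b : ℕ}
    (h : ∀ x : E, (σ₀ ^ a) • (x : AlgebraicClosure F) = (σ₀ ^ b) • (x : AlgebraicClosure F)) : a ≡ b [MOD Module.finrank F E] := by
  rw [← orderOf_restrictNormal_eq_finrank E hE hσ₀]
  exact pow_eq_pow_iff_modEq.mp (restrictNormal_pow_eq_of_forall_smul_eq E σ₀ h)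

omit hp in
/-- **`a ≡ b (mod p^m) ⟹ ω_m ∣ (1+X)^a − (1+X)^b`** (`ω_m = (1+X)^{p^m} − 1`). [cite: Washington1997, §7.1] -/
theorem omega_dvd_pow_sub_pow_of_modEq {S : Type*} [CommRing S] {m a b : ℕ} (h : a ≡ b [MOD p ^ m]) :
    ((1 + PowerSeries.X : PowerSeries S) ^ p ^ m - 1) ∣ (1 + PowerSeries.X : PowerSeries S) ^ a - (1 + PowerSeries.X) ^ b := by
  -- reduce to `a ≤ b`
  have key : ∀ {a b : ℕ}, a ≤ b → a ≡ b [MOD p ^ m] →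
      ((1 + PowerSeries.X : PowerSeries S) ^ p ^ m - 1) ∣ (1 + PowerSeries.X : PowerSeries S) ^ a - (1 + PowerSeries.X) ^ b := by
    intro a b hab hmod
    obtain ⟨k, hk⟩ := (Nat.modEq_iff_dvd' hab).mp hmod
    have hb : b = a + p ^ m * k := by omega
    have hdvd : ((1 + PowerSeries.X : PowerSeries S) ^ p ^ m - 1) ∣ ((1 + PowerSeries.X : PowerSeries S) ^ p ^ m) ^ k - 1 := by
      simpa using sub_dvd_pow_sub_pow ((1 + PowerSeries.X : PowerSeries S) ^ p ^ m) 1 k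
    have e : (1 + PowerSeries.X : PowerSeries S) ^ a - (1 + PowerSeries.X) ^ (a + p ^ m * k) =
        -((1 + PowerSeries.X) ^ a * (((1 + PowerSeries.X : PowerSeries S) ^ p ^ m) ^ k - 1)) := by
      rw [pow_add, pow_mul]; ring
    rw [hb, e]
    exact (Dvd.dvd.mul_left hdvd _).neg_right
  rcases le_total a b with hab | hab
  · exact key hab h
  · have e : (1 + PowerSeries.X : PowerSeries S) ^ a - (1 + PowerSeries.X) ^ b = -((1 + PowerSeries.X) ^ b - (1 + PowerSeries.X) ^ a) := by ring
    rw [e]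
    exact (key hab h.symm).neg_right

variable (E : ℕ → IntermediateField F (AlgebraicClosure F)) [∀ m, FiniteDimensional F (E m)] [∀ m, Normal F (E m)]
  [∀ m, IsGalois F (E m)] (hmono : Monotone E) (hE : ∀ m, E m ≤ maxUnramified F) (hdeg : ∀ m, Module.finrank F (E m) = p ^ m)
  {σ₀ : absoluteGaloisGroup F} (hσ₀ : IsAbsArithFrob σ₀)

omit hp in
include hmono hE hdeg hσ₀ in
/-- ★★ **The Amice element of `σ̃|_{E_∞}`**: for every `σ̃ ∈ Γ_F` there is `g ∈ 𝒪_F⟦X⟧` such that for every `m`, with `σ̃|_{E_m} = σ₀^{a}|_{E_m}`,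
`ω_m ∣ g − (1+X)^{a}` (the exponents are compatible modulo `p^m`, so `((1+X)^{a_m})_m` converges in `lim← 𝒪_F⟦X⟧/(ω_m) = 𝒪_F⟦X⟧`).
[cite: deShalit1987, Ch. I §3.1] -/
theorem exists_amice_galois [IsAdicComplete (Ideal.span {(p : 𝒪[F])}) 𝒪[F]] (σ : absoluteGaloisGroup F) :
    ∃ g : PowerSeries 𝒪[F], ∀ m, ∃ a : ℕ, (∀ x : E m, σ • (x : AlgebraicClosure F) = (σ₀ ^ a) • (x : AlgebraicClosure F)) ∧
      ((1 + PowerSeries.X : PowerSeries 𝒪[F]) ^ p ^ m - 1) ∣ g - (1 + PowerSeries.X) ^ a := by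
  have hex := fun m => exists_forall_smul_eq_pow_smul (E m) (hE m) hσ₀ σ
  choose a ha using hex
  -- compatibility of the exponents
  have hcompat : ∀ m, a (m + 1) ≡ a m [MOD p ^ m] := fun m => by
    rw [← hdeg m]
    refine modEq_of_forall_smul_eq (E m) (hE m) hσ₀ fun x => ?_
    have h1 : σ • (x : AlgebraicClosure F) = (σ₀ ^ a (m + 1)) • (x : AlgebraicClosure F) :=
      ha (m + 1) ⟨(x : AlgebraicClosure F), hmono (Nat.le_succ m) x.2⟩
    exact h1.symm.trans (ha m x)
  obtain ⟨g, hg⟩ := exists_forall_omega_dvd_sub p (fun m => (1 + PowerSeries.X : PowerSeries 𝒪[F]) ^ a m) fun m =>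
    omega_dvd_pow_sub_pow_of_modEq p (hcompat m)
  exact ⟨g, fun m => ⟨a m, ha m, hg m⟩⟩

omit hp in
include hE hdeg hσ₀ in
/-- **The Amice element is unique** (`⋂ (ω_m) = 0`). [cite: deShalit1987, Ch. I §3.1] -/
theorem amice_galois_unique [IsAdicComplete (Ideal.span {(p : 𝒪[F])}) 𝒪[F]] (σ : absoluteGaloisGroup F) {g g' : PowerSeries 𝒪[F]}
    (hg : ∀ m, ∃ a : ℕ, (∀ x : E m, σ • (x : AlgebraicClosure F) = (σ₀ ^ a) • (x : AlgebraicClosure F)) ∧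
      ((1 + PowerSeries.X : PowerSeries 𝒪[F]) ^ p ^ m - 1) ∣ g - (1 + PowerSeries.X) ^ a)
    (hg' : ∀ m, ∃ a : ℕ, (∀ x : E m, σ • (x : AlgebraicClosure F) = (σ₀ ^ a) • (x : AlgebraicClosure F)) ∧
      ((1 + PowerSeries.X : PowerSeries 𝒪[F]) ^ p ^ m - 1) ∣ g' - (1 + PowerSeries.X) ^ a) : g = g' := by
  refine eq_of_forall_omega_dvd_sub p fun m => ?_
  obtain ⟨a, ha, hga⟩ := hg m
  obtain ⟨b, hb, hgb⟩ := hg' m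
  have hab : a ≡ b [MOD p ^ m] := by
    rw [← hdeg m]
    exact modEq_of_forall_smul_eq (E m) (hE m) hσ₀ fun x => (ha x).symm.trans (hb x)
  have e : g - g' = (g - (1 + PowerSeries.X) ^ a) + ((1 + PowerSeries.X) ^ a - (1 + PowerSeries.X) ^ b) - (g' - (1 + PowerSeries.X) ^ b) := by
    ring
  rw [e]
  exact dvd_sub (dvd_add hga (omega_dvd_pow_sub_pow_of_modEq p hab)) hgb

omit [TopologicalSpace F] [IsNonarchimedeanLocalField F] [∀ m, FiniteDimensional F (E m)] [∀ m, Normal F (E m)]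
  [∀ m, IsGalois F (E m)] hp in
/-- **`g = 1` is the Amice element of any `σ̃` fixing every `E_m`** (exponent `0` at every level). [cite: deShalit1987, Ch. I §3.1] -/
theorem amice_galois_of_forall_smul_eq {σ₀' σ : absoluteGaloisGroup F} (hσE : ∀ m (x : E m), σ • (x : AlgebraicClosure F) = x) (m : ℕ) :
    ∃ a : ℕ, (∀ x : E m, σ • (x : AlgebraicClosure F) = (σ₀' ^ a) • (x : AlgebraicClosure F)) ∧
      ((1 + PowerSeries.X : PowerSeries 𝒪[F]) ^ p ^ m - 1) ∣ (1 : PowerSeries 𝒪[F]) - (1 + PowerSeries.X) ^ a :=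
  ⟨0, fun x => by rw [pow_zero, one_smul, hσE], by rw [pow_zero, sub_self]; exact dvd_zero _⟩

omit [TopologicalSpace F] [IsNonarchimedeanLocalField F] [∀ m, FiniteDimensional F (E m)] [∀ m, Normal F (E m)]
  [∀ m, IsGalois F (E m)] hp in
/-- **`g = 1 + X` is the Amice element of the Frobenius `σ₀`** (exponent `1` at every level). [cite: deShalit1987, Ch. I §3.1] -/
theorem amice_galois_frob (σ₀' : absoluteGaloisGroup F) (m : ℕ) :
    ∃ a : ℕ, (∀ x : E m, σ₀' • (x : AlgebraicClosure F) = (σ₀' ^ a) • (x : AlgebraicClosure F)) ∧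
      ((1 + PowerSeries.X : PowerSeries 𝒪[F]) ^ p ^ m - 1) ∣ (1 + PowerSeries.X : PowerSeries 𝒪[F]) - (1 + PowerSeries.X) ^ a :=
  ⟨1, fun x => by rw [pow_one], by rw [pow_one, sub_self]; exact dvd_zero _⟩

omit [TopologicalSpace F] [IsNonarchimedeanLocalField F] [∀ m, FiniteDimensional F (E m)] [∀ m, IsGalois F (E m)] hp in
/-- ★ **The Amice elements are multiplicative**: if `g` is an Amice element of `σ̃` and `g'` one of `τ̃`, then `g·g'` is one of `σ̃τ̃`
(exponents add levelwise). [cite: deShalit1987, Ch. I §3.1] -/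
theorem amice_galois_mul {σ₀' σ τ : absoluteGaloisGroup F} {g g' : PowerSeries 𝒪[F]}
    (hg : ∀ m, ∃ a : ℕ, (∀ x : E m, σ • (x : AlgebraicClosure F) = (σ₀' ^ a) • (x : AlgebraicClosure F)) ∧
      ((1 + PowerSeries.X : PowerSeries 𝒪[F]) ^ p ^ m - 1) ∣ g - (1 + PowerSeries.X) ^ a)
    (hg' : ∀ m, ∃ a : ℕ, (∀ x : E m, τ • (x : AlgebraicClosure F) = (σ₀' ^ a) • (x : AlgebraicClosure F)) ∧
      ((1 + PowerSeries.X : PowerSeries 𝒪[F]) ^ p ^ m - 1) ∣ g' - (1 + PowerSeries.X) ^ a) (m : ℕ) :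
    ∃ a : ℕ, (∀ x : E m, (σ * τ) • (x : AlgebraicClosure F) = (σ₀' ^ a) • (x : AlgebraicClosure F)) ∧
      ((1 + PowerSeries.X : PowerSeries 𝒪[F]) ^ p ^ m - 1) ∣ g * g' - (1 + PowerSeries.X) ^ a := by
  obtain ⟨a, ha, hga⟩ := hg m
  obtain ⟨b, hb, hgb⟩ := hg' m
  refine ⟨a + b, fun x => ?_, ?_⟩
  · -- `στ·x = σ·(σ₀^b x) = σ₀^a σ₀^b x`, using that `σ₀^b x ∈ E_m` (restriction to the normal `E_m`)
    have hmem : (σ₀' ^ b) • (x : AlgebraicClosure F) =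
        ((((absoluteGaloisGroup.toAlgEquiv F (σ₀' ^ b)).restrictNormal (E m)) x : E m) : AlgebraicClosure F) :=
      (coe_restrictNormal_apply (E m) (σ₀' ^ b) x).symm
    rw [mul_smul, hb, hmem, ha, ← hmem, ← mul_smul, ← pow_add]
  · have e : g * g' - (1 + PowerSeries.X) ^ (a + b) = g * (g' - (1 + PowerSeries.X) ^ b) + (1 + PowerSeries.X) ^ b * (g - (1 + PowerSeries.X) ^ a) := by
      rw [pow_add]; ring
    rw [e]
    exact dvd_add (Dvd.dvd.mul_left hgb _) (Dvd.dvd.mul_left hga _)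

/-! ### Transforms of Frobenius-twisted families -/

/-- `σ̃|_{𝒪_E} = φ^a` from `σ̃ = σ₀^a` on `E`. [cite: SerreLocalFields1979, Ch. IV §4 Prop. 16] -/
theorem frobUnitBall_eq_pow_of_forall_smul_eq (E' : IntermediateField F (AlgebraicClosure F)) [FiniteDimensional F E'] [Normal F E']
    {σ σ₀' : absoluteGaloisGroup F} {a : ℕ} (ha : ∀ x : E', σ • (x : AlgebraicClosure F) = (σ₀' ^ a) • (x : AlgebraicClosure F)) :
    (frobUnitBall E' σ : unitBall E' →+* unitBall E') = (frobUnitBall E' σ₀' : unitBall E' →+* unitBall E') ^ a := by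
  refine RingHom.ext fun c => ?_
  apply Subtype.ext; apply Subtype.ext
  have e1 : ((((frobUnitBall E' σ : unitBall E' →+* unitBall E') c : unitBall E') : E') : AlgebraicClosure F) =
      σ • ((c : E') : AlgebraicClosure F) := coe_restrictNormal_apply E' σ (c : E')
  rw [e1, ha c]
  clear ha e1
  induction a with
  | zero => rw [pow_zero, one_smul, pow_zero, RingHom.one_def, RingHom.id_apply]
  | succ a ih =>
    rw [pow_succ' σ₀', mul_smul, ih, pow_succ' (frobUnitBall E' σ₀' : unitBall E' →+* unitBall E'), RingHom.mul_def, RingHom.comp_apply]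
    exact (coe_restrictNormal_apply E' σ₀' _).symm

include hE hdeg hσ₀ in
/-- ★ **`C((1+X)^a)·G` is a transform of `((r_m)^{φ_m^a})_m`** (iterate `series_amice_frob`). [cite: deShalit1987, Ch. I §3.1, §3.8 (17)] -/
theorem series_amice_frob_pow {θ : ∀ m, unitBall (E m)} (hθ : ∀ m, IsIntegralNormalGen (E m) (θ m))
    (r : ∀ m, PowerSeries (unitBall (E m))) (G : PowerSeries (PowerSeries 𝒪[F]))
    (hG : ∀ m k, ((1 + PowerSeries.X : PowerSeries 𝒪[F]) ^ p ^ m - 1) ∣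
      PowerSeries.coeff k G - ∑ i : ZMod (p ^ m), PowerSeries.C ((hθ m).basis.repr (PowerSeries.coeff k (r m))
        (((absoluteGaloisGroup.toAlgEquiv F σ₀).restrictNormal (E m)) ^ i.val)) * (1 + PowerSeries.X) ^ i.val) (a : ℕ) (m k : ℕ) :
    ((1 + PowerSeries.X : PowerSeries 𝒪[F]) ^ p ^ m - 1) ∣
      PowerSeries.coeff k (PowerSeries.C ((1 + PowerSeries.X : PowerSeries 𝒪[F]) ^ a) * G) -
        ∑ i : ZMod (p ^ m), PowerSeries.C ((hθ m).basis.repr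
          (PowerSeries.coeff k (PowerSeries.map ((frobUnitBall (E m) σ₀ : unitBall (E m) →+* unitBall (E m)) ^ a) (r m)))
          (((absoluteGaloisGroup.toAlgEquiv F σ₀).restrictNormal (E m)) ^ i.val)) * (1 + PowerSeries.X) ^ i.val := by
  induction a generalizing m k with
  | zero =>
    rw [pow_zero, map_one, one_mul, pow_zero, RingHom.one_def, PowerSeries.map_id]
    exact hG m k
  | succ a ih =>
    have h := series_amice_frob p E hE hdeg hσ₀ hθ
      (fun n => PowerSeries.map ((frobUnitBall (E n) σ₀ : unitBall (E n) →+* unitBall (E n)) ^ a) (r n))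
      (PowerSeries.C ((1 + PowerSeries.X : PowerSeries 𝒪[F]) ^ a) * G) ih m k
    rw [← mul_assoc, ← map_mul, ← pow_succ'] at h
    have e : ∀ n, PowerSeries.map (frobUnitBall (E n) σ₀ : unitBall (E n) →+* unitBall (E n))
        (PowerSeries.map ((frobUnitBall (E n) σ₀ : unitBall (E n) →+* unitBall (E n)) ^ a) (r n)) =
        PowerSeries.map ((frobUnitBall (E n) σ₀ : unitBall (E n) →+* unitBall (E n)) ^ (a + 1)) (r n) := fun n => by
      rw [← RingHom.comp_apply (PowerSeries.map _), ← PowerSeries.map_comp, ← RingHom.mul_def, ← pow_succ']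
    rw [e] at h
    exact h

include hE hdeg hσ₀ in
/-- ★★ **`C(g_{σ̃})·G` is a transform of the coefficient-twisted family `((r_m)^{σ̃|E_m})_m`** for the Amice element `g_{σ̃}` of
`exists_amice_galois`. [cite: deShalit1987, Ch. I §3.1, §3.8 (17)] -/
theorem series_amice_galois {θ : ∀ m, unitBall (E m)} (hθ : ∀ m, IsIntegralNormalGen (E m) (θ m))
    (r : ∀ m, PowerSeries (unitBall (E m))) (G : PowerSeries (PowerSeries 𝒪[F]))
    (hG : ∀ m k, ((1 + PowerSeries.X : PowerSeries 𝒪[F]) ^ p ^ m - 1) ∣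
      PowerSeries.coeff k G - ∑ i : ZMod (p ^ m), PowerSeries.C ((hθ m).basis.repr (PowerSeries.coeff k (r m))
        (((absoluteGaloisGroup.toAlgEquiv F σ₀).restrictNormal (E m)) ^ i.val)) * (1 + PowerSeries.X) ^ i.val)
    (σ : absoluteGaloisGroup F) {g : PowerSeries 𝒪[F]}
    (hg : ∀ m, ∃ a : ℕ, (∀ x : E m, σ • (x : AlgebraicClosure F) = (σ₀ ^ a) • (x : AlgebraicClosure F)) ∧
      ((1 + PowerSeries.X : PowerSeries 𝒪[F]) ^ p ^ m - 1) ∣ g - (1 + PowerSeries.X) ^ a) (m k : ℕ) :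
    ((1 + PowerSeries.X : PowerSeries 𝒪[F]) ^ p ^ m - 1) ∣
      PowerSeries.coeff k (PowerSeries.C g * G) - ∑ i : ZMod (p ^ m), PowerSeries.C ((hθ m).basis.repr
        (PowerSeries.coeff k (PowerSeries.map (frobUnitBall (E m) σ : unitBall (E m) →+* unitBall (E m)) (r m)))
        (((absoluteGaloisGroup.toAlgEquiv F σ₀).restrictNormal (E m)) ^ i.val)) * (1 + PowerSeries.X) ^ i.val := by
  obtain ⟨a, ha, hga⟩ := hg m
  have h := series_amice_frob_pow p E hE hdeg hσ₀ hθ r G hG a m k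
  rw [← frobUnitBall_eq_pow_of_forall_smul_eq (E m) ha] at h
  have e : PowerSeries.coeff k (PowerSeries.C g * G) = PowerSeries.coeff k (PowerSeries.C ((1 + PowerSeries.X : PowerSeries 𝒪[F]) ^ a) * G) +
      (g - (1 + PowerSeries.X) ^ a) * PowerSeries.coeff k G := by
    rw [PowerSeries.coeff_C_mul, PowerSeries.coeff_C_mul]; ring
  rw [e, add_sub_right_comm]
  exact dvd_add h (Dvd.dvd.mul_right hga _)

/-! ### The transform of `σ̃·β` for every `σ̃` -/

include hdeg in
/-- ★★★ **`Col(σ̃·β) = (1 + D^{𝒪⟦X⟧}_{χ(σ̃)})(C(g_{σ̃})·Col(β))` for EVERY `σ̃ ∈ Γ_F`**: if `G` is the transform of a baseNorm-coherent family `β`,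
`G'` the transform of `(σ̃·β_m)_m`, and `g` the Amice element of `σ̃|_{E_∞}` (`exists_amice_galois`), then `G' = C(g)·G + D_{χ(σ̃)}(C(g)·G)`:
the two-variable Coleman transform intertwines the whole Galois group of the tower with the `𝒪_F⟦X⟧⟦T⟧`-structure of `𝒪_F⟦X⟧⟦Y⟧`
(`σ̃ ↦ (g_{σ̃}, χ(σ̃))`). [cite: deShalit1987, Ch. I §3.1, §3.4, §3.8 (17); Ch. III §1.3] -/
theorem colemanTransform₂_galois_eq [IsAdicComplete (Ideal.span {(p : 𝒪[F])}) 𝒪[F]] {θ : ∀ m, unitBall (E m)}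
    (hθ : ∀ m, IsIntegralNormalGen (E m) (θ m)) (hcoh : ∀ m, unitBallTrace (hmono (Nat.le_succ m)) (θ (m + 1)) = θ m)
    (u : (LTCoeff F)ˣ) (hu : LTCoeff.of F π = residueFieldCard F * u) {β : ∀ m, RelNormCoherentUnits hπ (E m)}
    (hβ : ∀ m, (β (m + 1)).baseNorm hπ (hmono (Nat.le_succ m)) = β m) (σ : absoluteGaloisGroup F) {g : PowerSeries 𝒪[F]}
    (hg : ∀ m, ∃ a : ℕ, (∀ x : E m, σ • (x : AlgebraicClosure F) = (σ₀ ^ a) • (x : AlgebraicClosure F)) ∧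
      ((1 + PowerSeries.X : PowerSeries 𝒪[F]) ^ p ^ m - 1) ∣ g - (1 + PowerSeries.X) ^ a) {G G' : PowerSeries (PowerSeries 𝒪[F])}
    (hG : ∀ m k, ((1 + PowerSeries.X : PowerSeries 𝒪[F]) ^ p ^ m - 1) ∣
      PowerSeries.coeff k G - ∑ i : ZMod (p ^ m), PowerSeries.C ((hθ m).basis.repr
        (PowerSeries.coeff k (relUnitCoordTwo hπ (E m) hq (hE m) hσ₀ u hu (β m)))
        (((absoluteGaloisGroup.toAlgEquiv F σ₀).restrictNormal (E m)) ^ i.val)) * (1 + PowerSeries.X) ^ i.val)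
    (hG' : ∀ m k, ((1 + PowerSeries.X : PowerSeries 𝒪[F]) ^ p ^ m - 1) ∣
      PowerSeries.coeff k G' - ∑ i : ZMod (p ^ m), PowerSeries.C ((hθ m).basis.repr
        (PowerSeries.coeff k (relUnitCoordTwo hπ (E m) hq (hE m) hσ₀ u hu ((β m).galAct σ)))
        (((absoluteGaloisGroup.toAlgEquiv F σ₀).restrictNormal (E m)) ^ i.val)) * (1 + PowerSeries.X) ^ i.val) :
    G' = PowerSeries.C g * G +
      twistLinearBase hπ hq ((PowerSeries.C (R := 𝒪[F])).comp (LTCoeff.of F).symm.toRingHom) u (lubinTateChar hπ σ) (PowerSeries.C g * G) :=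
  (existsUnique_colemanTransform₂ p hπ E hmono hE hdeg hσ₀ hq hθ hcoh u hu (galAct_baseNormCoherent hπ E hmono σ hβ)).unique hG'
    (isColemanTransform₂_galAct_general hπ hq p E hE hσ₀ hθ u hu β σ
      (series_amice_galois p E hE hdeg hσ₀ hθ (fun n => relUnitCoordTwo hπ (E n) hq (hE n) hσ₀ u hu (β n)) G hG σ hg))

end TwoVariableTwistGaloisTwo

end Literature.NumberTheory.GaloisRepresentations
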